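import Literature.Topology.FourManifolds.LargeKTrisectionClassificationUniv
import Literature.Topology.FourManifolds.CircleProdSumEuler
import Literature.Topology.FourManifolds.ConnectedSumAmphichiralUniqueness
import Literature.Topology.FourManifolds.SphereIsometryDiffeotopy
import Literature.Topology.FourManifolds.ConnectedSumTransportProofs
import HarnessLib

/-!
# `#ᵏ(S¹ × S³)` is well defined up to diffeomorphism (`IsCircleProdSum k` has one diffeomorphism type)

Topic `Literature/Topology/FourManifolds`, proofs companion of `LargeKTrisectionClassification.lean`
(the Meier–Schirmer–Zupan classification fact `msz_trisection_classification_gk` and its normal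
form `Literature.Topology.FourManifolds.IsCircleProdSum k P`, "`P` is a connected sum of `k` copies
of `S¹ × S³`").  The normal form is an inductive family built on the tree's HONEST gluing
predicate `IsConnectedSum` (`ConnectedSum.lean`): `P ≅ S⁴` for `k = 0`, and `P` is *a* connected
sum `M # (S¹ × S³)` — along arbitrary smooth discs, no orientation convention, `S¹ × S³` being
Mathlib's `Circle × 𝕊³` on the product model — of some closed connected smooth `M` with
`IsCircleProdSum k M` for `k + 1`.  The printed theorem (MSZ 2016, Thm. 1.2) says "`X` is
diffeomorphic to `#^{k′}(S¹ × S³)`", a statement about ONE diffeomorphism type; this file proves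
that the predicate indeed pins down one diffeomorphism type, and records the connected-sum
arithmetic with the unit `S⁴` used when the conclusions of the theorem are assembled along a
connected sum of trisections (MSZ §5, proof of Thm. 1.2: "must be the connected sum of `k₂ = k₃`
copies of `S¹ × S³`"; "both `𝒯′` and `𝒯″` satisfy the conclusions of the theorem"):

* `Literature.Topology.FourManifolds.exists_split_reflection_one_three` — linear algebra:
  `Λ : ℝ⁴ ≅ ℝ¹ × ℝ³`, the reflection `r` of the first coordinate of `ℝ⁴` (`det r < 0`) and the
  reflection `r′` of `ℝ¹` with `Λ (r y) = (r′ (Λ y).1, (Λ y).2)`.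
* `Literature.Topology.FourManifolds.sphereOneProdSphereThree_discs_equivalent` — **any two discs
  `ℝ⁴ → S¹ × S³` are related by a diffeomorphism of `S¹ × S³`** (round factors `𝕊¹ ⊆ ℝ²`,
  `𝕊³ ⊆ ℝ⁴`, model `(𝓡 1).prod (𝓡 3)`): by the tree's `discs_equivalent_of_equivariant_disc` (the
  unoriented disc theorem, `UnorientedDiscTheorem.lean`; Hirsch Ch. 8 §3 Thm. 3.1, Kosinski III
  (3.6)) it suffices to give one reflection-equivariant disc, `c = (σ₁⁻¹ × σ₃⁻¹) ∘ Λ` for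
  stereographic charts `σ₁` of `𝕊¹`, `σ₃` of `𝕊³`, equivariant under `ρ = sphereCongr J × id`
  with `J` the isometry of `ℝ²` which reads `r′` in the chart `σ₁`
  (`exists_linearIsometryEquiv_stereographic'_conj`) — the classical remark that `S¹ × S³` admits
  an orientation-reversing diffeomorphism (complex conjugation on the `S¹` factor), exactly as
  the tree does for `S² × S²` (`sphereTwoProd_discs_equivalent`) and `S² × S¹`
  (`sphereTwoProdCircle_discs_equivalent`).
* `Literature.Topology.FourManifolds.circleProdSphereThree_discs_equivalent` — the same for
  Mathlib's `Circle × 𝕊³` (the summand used by `IsCircleProdSum`), by conjugating with the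
  diffeomorphism `Circle ≅ 𝕊¹` (`nonempty_diffeomorph_circle_sphereOne`).
* `Literature.Topology.FourManifolds.nonempty_diffeomorph_of_isConnectedSum_sphereOneProdSphereThree`,
  `Literature.Topology.FourManifolds.nonempty_diffeomorph_of_isConnectedSum_circleProdSphereThree`
  — hence **`M # (S¹ × S³)` is well defined**: any two connected sums of a connected `M` (any
  model over `ℝ⁴`) with `S¹ × S³` are diffeomorphic (Kervaire–Milnor (1963), Lemma 2.1 with the
  remark on orientation-reversing automorphisms; Kosinski VI (1.1)), by
  `nonempty_diffeomorph_of_isConnectedSum_of_discs_equivalent`.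
* `Literature.Topology.FourManifolds.IsCircleProdSum.nonempty_diffeomorph` — **two `4`-manifolds
  satisfying `IsCircleProdSum k` are diffeomorphic**, by induction on `k` (`k = 0`: both are
  `S⁴`; `k + 1`: the summands are diffeomorphic by induction, transport one connected sum along
  that diffeomorphism, `IsConnectedSum.of_diffeomorph_left`, and compare the two connected sums
  `M′ # (S¹ × S³)` by the previous theorem).  Consequently `IsCircleProdSum k` is CLOSED under
  diffeomorphism in both directions (`IsCircleProdSum.of_diffeomorph`, already in the statement
  file, and `IsCircleProdSum.iff_nonempty_diffeomorph` here): "`X ≅ #ᵏ(S¹ × S³)`" in the printed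
  sense and `IsCircleProdSum k X` agree.
* Unit and first summand (Kervaire–Milnor: "`Sⁿ` serves as identity element"):
  `IsCircleProdSum.of_isConnectedSum_sphere_right`, `.of_isConnectedSum_zero_right/left`
  (`P # Q` with `Q ≅ S⁴` has as many `S¹ × S³` summands as `P`; the tree's proved
  `nonempty_diffeomorph_of_isConnectedSum_sphere'`), `.succ_of_diffeomorph` (the new summand need
  only be diffeomorphic to `Circle × 𝕊³`, on any boundaryless model: cross-model transport
  `IsConnectedSum.of_diffeomorph_right_of_boundaryless`), `.one_of_diffeomorph` (a manifold
  diffeomorphic to `S¹ × S³` is `#¹(S¹ × S³)`, any universe).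

Everything is proved; no definition and no named fact is introduced (the linear-algebra data are
packaged as an existence lemma, as in the `S² × S²` and `S² × S¹` files).  NOT here: additivity
`#ᵐ # #ⁿ = #ᵐ⁺ⁿ` for two composite summands, which needs the re-bracketing
`P # (M # C) ≅ (P # M) # C` of UNORIENTED sums (the tree has associativity for oriented sums,
`isOrientedConnectedSum_assoc_holds`; the upgrade of an unoriented connected sum of orientable
pieces to an oriented one is not yet in the tree).

## References

* J. Meier, T. Schirmer, A. Zupan, *Classification of trisections and the Generalized Property R
  Conjecture*, Proc. AMS 144 (2016) 4983–4997 (arXiv:1507.06561), Thm. 1.2 and its proof, §5.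
  [MeierSchirmerZupan2016]
* M. Kervaire, J. Milnor, *Groups of homotopy spheres I*, Ann. of Math. 77 (1963), §2,
  Lemma 2.1 ("well defined, associative, and commutative"; "`Sⁿ` serves as identity element").
  [KervaireMilnorAnnals1963]
* A. Kosinski, *Differential Manifolds* (1993), Ch. III Thm. (3.6), Ch. VI §1 Thm. (1.1) and the
  discussion of orientation conventions after it. [Kosinski1993]
* M. W. Hirsch, *Differential Topology*, GTM 33 (1976), Ch. 8 §3, Thm. 3.1. [HirschDT1976]
* J. Meier, A. Zupan, *Genus-two trisections are standard*, Geom. Topol. 21 (2017), §1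
  (`#⁰(S¹ × S³) = S⁴`). [MeierZupan2017]
-/

noncomputable section

open scoped Manifold ContDiff Topology RealInnerProductSpace
open Set Module Function Filter OpenPartialHomeomorph Metric

namespace Literature.Topology.FourManifolds

universe u v

/-! ### Linear algebra on `ℝ⁴ = ℝ¹ × ℝ³`: splitting and the reflection of the first coordinate -/

/-- **Splitting `ℝ⁴ ≅ ℝ¹ × ℝ³` and a compatible pair of reflections.** There are a linear
isomorphism `Λ : ℝ⁴ ≅ ℝ¹ × ℝ³` (`y ↦ (y₀, (y₁, y₂, y₃))`), a linear isometry `r` of `ℝ⁴` of negative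
determinant (the reflection `y₀ ↦ -y₀`, Mathlib's `Submodule.reflection` in the hyperplane
orthogonal to `e₀`) and a linear isometry `r'` of `ℝ¹` (the reflection `a ↦ -a`) with
`Λ (r y) = (r' (Λ y).1, (Λ y).2)`.  Stated as an existence lemma (no definitions in this file),
after `exists_split_reflection` of the `S² × S²` file. [folklore] -/
theorem exists_split_reflection_one_three :
    ∃ (Λ : EuclideanSpace ℝ (Fin 4) ≃L[ℝ] EuclideanSpace ℝ (Fin 1) × EuclideanSpace ℝ (Fin 3))
      (r : EuclideanSpace ℝ (Fin 4) ≃ₗᵢ[ℝ] EuclideanSpace ℝ (Fin 4))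
      (r' : EuclideanSpace ℝ (Fin 1) ≃ₗᵢ[ℝ] EuclideanSpace ℝ (Fin 1)),
      LinearMap.det (r.toLinearEquiv : EuclideanSpace ℝ (Fin 4) →ₗ[ℝ] EuclideanSpace ℝ (Fin 4))
          < 0 ∧
        ∀ y, Λ (r y) = (r' (Λ y).1, (Λ y).2) := by
  -- the splitting isomorphism
  let Λ : EuclideanSpace ℝ (Fin 4) ≃ₗ[ℝ] EuclideanSpace ℝ (Fin 1) × EuclideanSpace ℝ (Fin 3) :=
    { toFun := fun y => (!₂[y 0], !₂[y 1, y 2, y 3])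
      invFun := fun z => !₂[z.1 0, z.2 0, z.2 1, z.2 2]
      map_add' := fun x y => by
        refine Prod.ext ?_ ?_
        · ext i; fin_cases i; simp
        · ext i; fin_cases i <;> simp
      map_smul' := fun a x => by
        refine Prod.ext ?_ ?_
        · ext i; fin_cases i; simp
        · ext i; fin_cases i <;> simp
      left_inv := fun y => by
        ext i
        fin_cases i <;> simp
      right_inv := fun z => by
        obtain ⟨a, b⟩ := z
        refine Prod.ext ?_ ?_
        · ext i; fin_cases i; simp
        · ext i; fin_cases i <;> simp }
  -- the reflections of the first coordinate
  set e₀ : EuclideanSpace ℝ (Fin 4) := EuclideanSpace.single 0 1 with he₀_def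
  set e₀' : EuclideanSpace ℝ (Fin 1) := EuclideanSpace.single 0 1 with he₀'_def
  have he₀ : e₀ ≠ 0 := fun h => by
    have := congrArg (fun v : EuclideanSpace ℝ (Fin 4) => v 0) h
    simp [he₀_def] at this
  have hr : ∀ y : EuclideanSpace ℝ (Fin 4), (ℝ ∙ e₀)ᗮ.reflection y = !₂[-(y 0), y 1, y 2, y 3] :=
    fun y => by
      rw [reflection_orthogonal_singleton_apply]
      ext i
      fin_cases i
      · simp [he₀_def, EuclideanSpace.inner_single_left]; ring
      · simp [he₀_def, EuclideanSpace.inner_single_left]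
      · simp [he₀_def, EuclideanSpace.inner_single_left]
      · simp [he₀_def, EuclideanSpace.inner_single_left]
  have hr' : ∀ a : EuclideanSpace ℝ (Fin 1), (ℝ ∙ e₀')ᗮ.reflection a = !₂[-(a 0)] :=
    fun a => by
      rw [reflection_orthogonal_singleton_apply]
      ext i
      fin_cases i
      simp [he₀'_def, EuclideanSpace.inner_single_left]; ring
  refine ⟨Λ.toContinuousLinearEquiv, (ℝ ∙ e₀)ᗮ.reflection, (ℝ ∙ e₀')ᗮ.reflection, ?_, fun y => ?_⟩
  · -- `det = -1`
    have h := (ℝ ∙ e₀)ᗮ.det_reflection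
    have hKo : (ℝ ∙ e₀)ᗮᗮ = ℝ ∙ e₀ := Submodule.orthogonal_orthogonal _
    rw [hKo, finrank_span_singleton he₀, pow_one] at h
    have h' : LinearMap.det ((ℝ ∙ e₀)ᗮ.reflection.toLinearEquiv :
        EuclideanSpace ℝ (Fin 4) →ₗ[ℝ] EuclideanSpace ℝ (Fin 4)) = -1 := h
    rw [h']
    norm_num
  · -- coordinates
    rw [hr y]
    show (Λ !₂[-(y 0), y 1, y 2, y 3]) = ((ℝ ∙ e₀')ᗮ.reflection (Λ y).1, (Λ y).2)
    rw [hr']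
    refine Prod.ext ?_ ?_
    · ext i; fin_cases i; simp [Λ]
    · ext i; fin_cases i <;> simp [Λ]

/-! ### Every two discs of `S¹ × S³` are equivalent -/

/-- **Any two discs `ℝ⁴ → S¹ × S³` are related by a diffeomorphism of `S¹ × S³`** (on the closed
unit ball), for the round factors `𝕊¹ ⊆ ℝ²`, `𝕊³ ⊆ ℝ⁴` with Mathlib's product of the analytic
structures (model `(𝓡 1).prod (𝓡 3)`): the hypothesis `hN` of
`nonempty_diffeomorph_of_isConnectedSum_of_discs_equivalent` for the summand `S¹ × S³`.  By
`discs_equivalent_of_equivariant_disc` (unoriented disc theorem in `S¹ × S³`) it suffices to give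
one reflection-equivariant disc: `c = (σ₁⁻¹ × σ₃⁻¹) ∘ Λ` for the stereographic charts
`σ₁ = stereographic' 1 q`, `σ₃ = stereographic' 3 p`, equivariant under `ρ = sphereCongr J × id`,
`J` the isometry of `ℝ²` fixing `q` which is the reflection `r'` of `ℝ¹` in the chart `σ₁`
(`exists_linearIsometryEquiv_stereographic'_conj`).  This is the classical remark that `S¹ × S³`
admits an orientation-reversing diffeomorphism (a reflection of the `S¹` factor), whence
`M # (S¹ × S³)` needs no orientation convention (Kervaire–Milnor 1963, §2; Kosinski 1993, VI §1,
discussion after Thm. (1.1)). [cite: Kosinski1993, Ch. VI §1, Thm (1.1)]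
[cite: KervaireMilnorAnnals1963, §2, Lemma 2.1 (p. 505)] -/
theorem sphereOneProdSphereThree_discs_equivalent
    (k k' : EuclideanSpace ℝ (Fin 4) →
      Metric.sphere (0 : EuclideanSpace ℝ (Fin 2)) 1 × Metric.sphere (0 : EuclideanSpace ℝ (Fin 4)) 1)
    (hk : Manifold.IsSmoothEmbedding 𝓘(ℝ, EuclideanSpace ℝ (Fin 4)) ((𝓡 1).prod (𝓡 3)) ∞ k)
    (hk' : Manifold.IsSmoothEmbedding 𝓘(ℝ, EuclideanSpace ℝ (Fin 4)) ((𝓡 1).prod (𝓡 3)) ∞ k') :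
    ∃ g : (Metric.sphere (0 : EuclideanSpace ℝ (Fin 2)) 1 ×
        Metric.sphere (0 : EuclideanSpace ℝ (Fin 4)) 1) ≃ₘ⟮(𝓡 1).prod (𝓡 3), (𝓡 1).prod (𝓡 3)⟯
        (Metric.sphere (0 : EuclideanSpace ℝ (Fin 2)) 1 ×
          Metric.sphere (0 : EuclideanSpace ℝ (Fin 4)) 1),
      ∀ y : EuclideanSpace ℝ (Fin 4), ‖y‖ ≤ 1 → g (k y) = k' y := by
  -- the dimension `Fact`s consumed by Mathlib's `stereographic'` (inside the proof only)
  haveI : Fact (finrank ℝ (EuclideanSpace ℝ (Fin 2)) = 1 + 1) := ⟨by simp⟩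
  haveI : Fact (finrank ℝ (EuclideanSpace ℝ (Fin 4)) = 3 + 1) := ⟨by simp⟩
  obtain ⟨Λ, r, r', hr, hΛr⟩ := exists_split_reflection_one_three
  -- the poles and their stereographic charts
  set q : Metric.sphere (0 : EuclideanSpace ℝ (Fin 2)) 1 :=
    ⟨EuclideanSpace.single 0 1, by simp⟩ with hq_def
  set p : Metric.sphere (0 : EuclideanSpace ℝ (Fin 4)) 1 :=
    ⟨EuclideanSpace.single 0 1, by simp⟩ with hp_def
  set σ := stereographic' 1 q with hσ_def
  set τ := stereographic' 3 p with hτ_def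
  have hσt : σ.target = univ := stereographic'_target q
  have hσs : σ.source = {q}ᶜ := stereographic'_source q
  have hτt : τ.target = univ := stereographic'_target p
  have hτs : τ.source = {p}ᶜ := stereographic'_source p
  -- the isometry of `ℝ²` fixing `q` which reads `r'` in the chart `σ`
  obtain ⟨J, hJq, hJ⟩ := exists_linearIsometryEquiv_stereographic'_conj q q r'
  have hJq' : sphereCongr J q = q := Subtype.ext (by simpa using hJq)
  have hJσ : ∀ a : EuclideanSpace ℝ (Fin 1), sphereCongr J (σ.symm a) = σ.symm (r' a) := by
    intro a
    have ha : a ∈ σ.target := by rw [hσt]; trivial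
    have h1 : σ.symm a ∈ σ.source := σ.map_target ha
    have h1' : σ.symm a ≠ q := by rw [hσs] at h1; exact h1
    have h2 : sphereCongr J (σ.symm a) ∈ σ.source := by
      rw [hσs]
      intro h
      exact h1' ((sphereCongr J).injective (h.trans hJq'.symm))
    have h3 : σ (sphereCongr J (σ.symm a)) = r' a := by
      rw [hJ (σ.symm a), σ.right_inv ha]
    rw [← h3, σ.left_inv h2]
  -- the product chart inverse is a disc `ℝ¹ × ℝ³ → S¹ × S³`
  have hc₀ : Manifold.IsSmoothEmbedding 𝓘(ℝ, EuclideanSpace ℝ (Fin 1) × EuclideanSpace ℝ (Fin 3))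
      ((𝓡 1).prod (𝓡 3)) ∞ (σ.prod τ).symm := by
    have hsrc : (σ.prod τ).symm.source = univ := by
      rw [OpenPartialHomeomorph.symm_source, OpenPartialHomeomorph.prod_target, hσt, hτt,
        univ_prod_univ]
    have hΦ : ContMDiffOn 𝓘(ℝ, EuclideanSpace ℝ (Fin 1) × EuclideanSpace ℝ (Fin 3))
        ((𝓡 1).prod (𝓡 3)) ∞ (σ.prod τ).symm (σ.prod τ).symm.source := by
      rw [hsrc, modelWithCornersSelf_prod, ← chartedSpaceSelf_prod]
      exact ((contMDiff_stereographic'_symm q).prodMap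
        (contMDiff_stereographic'_symm p)).contMDiffOn
    have hΦ' : ContMDiffOn ((𝓡 1).prod (𝓡 3))
        𝓘(ℝ, EuclideanSpace ℝ (Fin 1) × EuclideanSpace ℝ (Fin 3)) ∞ (σ.prod τ).symm.symm
        (σ.prod τ).symm.target := by
      rw [OpenPartialHomeomorph.symm_symm, OpenPartialHomeomorph.symm_target,
        OpenPartialHomeomorph.prod_source, hσs, hτs, modelWithCornersSelf_prod,
        ← chartedSpaceSelf_prod]
      exact (contMDiffOn_stereographic' q).prodMap (contMDiffOn_stereographic' p)
    exact isSmoothEmbedding_of_openPartialHomeomorph _ hsrc hΦ hΦ'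
      (ContinuousLinearEquiv.refl ℝ _)
  -- the equivariant disc `c = (σ⁻¹ × τ⁻¹) ∘ Λ` of `S¹ × S³`
  have hc : Manifold.IsSmoothEmbedding 𝓘(ℝ, EuclideanSpace ℝ (Fin 4)) ((𝓡 1).prod (𝓡 3)) ∞
      ((σ.prod τ).symm ∘ (Λ : EuclideanSpace ℝ (Fin 4) → _)) := by
    have h := isSmoothEmbedding_disc_comp_symm hc₀ (by simp) Λ.symm
    rwa [ContinuousLinearEquiv.symm_symm] at h
  -- the symmetry `ρ = sphereCongr J × id`
  set ρ := (sphereCongr J).prodCongr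
    (Diffeomorph.refl (𝓡 3) (Metric.sphere (0 : EuclideanSpace ℝ (Fin 4)) 1) ∞) with hρ_def
  have hρ : ∀ y : EuclideanSpace ℝ (Fin 4),
      ρ (((σ.prod τ).symm ∘ (Λ : EuclideanSpace ℝ (Fin 4) → _)) y) =
        ((σ.prod τ).symm ∘ (Λ : EuclideanSpace ℝ (Fin 4) → _)) (r y) := by
    intro y
    simp only [comp_apply, hΛr, OpenPartialHomeomorph.prod_symm,
      OpenPartialHomeomorph.prod_apply, hρ_def, Diffeomorph.coe_prodCongr, Prod.map_apply,
      Diffeomorph.coe_refl, id_eq, hJσ]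
  -- connectedness of `S¹ × S³`
  haveI : ConnectedSpace (Metric.sphere (0 : EuclideanSpace ℝ (Fin 2)) 1) := by
    refine isConnected_iff_connectedSpace.mp (isConnected_sphere ?_ 0 zero_le_one)
    rw [← Module.finrank_eq_rank, finrank_euclideanSpace_fin]
    norm_num
  haveI : ConnectedSpace (Metric.sphere (0 : EuclideanSpace ℝ (Fin 4)) 1) := by
    refine isConnected_iff_connectedSpace.mp (isConnected_sphere ?_ 0 zero_le_one)
    rw [← Module.finrank_eq_rank, finrank_euclideanSpace_fin]
    norm_num
  have hE : finrank ℝ (EuclideanSpace ℝ (Fin 4)) ≠ 0 := by simp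
  exact discs_equivalent_of_equivariant_disc (IN := (𝓡 1).prod (𝓡 3)) hE Λ r hr hc ρ hρ k k'
    hk hk'

/-- **Any two discs `ℝ⁴ → Circle × 𝕊³` are related by a diffeomorphism of `Circle × 𝕊³`** (the
summand of `IsCircleProdSum`, Mathlib's circle group times the round `3`-sphere, model
`(𝓡 1).prod (𝓡 3)`): conjugate `sphereOneProdSphereThree_discs_equivalent` by the diffeomorphism
`Circle × 𝕊³ ≅ 𝕊¹ × 𝕊³` (`nonempty_diffeomorph_circle_sphereOne` on the first factor); discs
followed by a diffeomorphism are discs (`isSmoothEmbedding_diffeomorph_comp_of_range_eq`, same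
model). [cite: Kosinski1993, Ch. VI §1, Thm (1.1)] -/
theorem circleProdSphereThree_discs_equivalent
    (k k' : EuclideanSpace ℝ (Fin 4) → Circle × Metric.sphere (0 : EuclideanSpace ℝ (Fin 4)) 1)
    (hk : Manifold.IsSmoothEmbedding 𝓘(ℝ, EuclideanSpace ℝ (Fin 4)) ((𝓡 1).prod (𝓡 3)) ∞ k)
    (hk' : Manifold.IsSmoothEmbedding 𝓘(ℝ, EuclideanSpace ℝ (Fin 4)) ((𝓡 1).prod (𝓡 3)) ∞ k') :
    ∃ g : (Circle × Metric.sphere (0 : EuclideanSpace ℝ (Fin 4)) 1)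
        ≃ₘ⟮(𝓡 1).prod (𝓡 3), (𝓡 1).prod (𝓡 3)⟯
        (Circle × Metric.sphere (0 : EuclideanSpace ℝ (Fin 4)) 1),
      ∀ y : EuclideanSpace ℝ (Fin 4), ‖y‖ ≤ 1 → g (k y) = k' y := by
  obtain ⟨ψ⟩ := nonempty_diffeomorph_circle_sphereOne
  set Φ : (Circle × Metric.sphere (0 : EuclideanSpace ℝ (Fin 4)) 1)
      ≃ₘ⟮(𝓡 1).prod (𝓡 3), (𝓡 1).prod (𝓡 3)⟯
      (Metric.sphere (0 : EuclideanSpace ℝ (Fin 2)) 1 × Metric.sphere (0 : EuclideanSpace ℝ (Fin 4)) 1) :=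
    ψ.prodCongr (Diffeomorph.refl (𝓡 3) (Metric.sphere (0 : EuclideanSpace ℝ (Fin 4)) 1) ∞)
    with hΦ_def
  have hΦk : Manifold.IsSmoothEmbedding 𝓘(ℝ, EuclideanSpace ℝ (Fin 4)) ((𝓡 1).prod (𝓡 3)) ∞
      (Φ ∘ k) := isSmoothEmbedding_diffeomorph_comp_of_range_eq hk Φ rfl
  have hΦk' : Manifold.IsSmoothEmbedding 𝓘(ℝ, EuclideanSpace ℝ (Fin 4)) ((𝓡 1).prod (𝓡 3)) ∞
      (Φ ∘ k') := isSmoothEmbedding_diffeomorph_comp_of_range_eq hk' Φ rfl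
  obtain ⟨g, hg⟩ := sphereOneProdSphereThree_discs_equivalent (Φ ∘ k) (Φ ∘ k') hΦk hΦk'
  refine ⟨Φ.trans (g.trans Φ.symm), fun y hy => ?_⟩
  show Φ.symm (g (Φ (k y))) = k' y
  have h := hg y hy
  simp only [comp_apply] at h
  rw [h, Diffeomorph.symm_apply_apply]

/-! ### `M # (S¹ × S³)` is well defined -/

section WellDefined

variable {HM HP HP' : Type*} [TopologicalSpace HM] [TopologicalSpace HP] [TopologicalSpace HP']
  {IM : ModelWithCorners ℝ (EuclideanSpace ℝ (Fin 4)) HM}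
  {IP : ModelWithCorners ℝ (EuclideanSpace ℝ (Fin 4)) HP}
  {IP' : ModelWithCorners ℝ (EuclideanSpace ℝ (Fin 4)) HP'}
  {M P P' : Type*} [TopologicalSpace M] [T2Space M] [ChartedSpace HM M] [IsManifold IM ∞ M]
  [TopologicalSpace P] [ChartedSpace HP P] [IsManifold IP ∞ P]
  [TopologicalSpace P'] [ChartedSpace HP' P'] [IsManifold IP' ∞ P']

/-- **`M # (S¹ × S³)` is well defined up to diffeomorphism** (round factors): for a connected
Hausdorff `C^∞` manifold `M` with any real model over `ℝ⁴` (with or without boundary, orientable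
or not), any two connected sums `P`, `P'` of `M` with `𝕊¹ × 𝕊³` in the tree's relational sense
(`IsConnectedSum`, along arbitrary discs; any models `IP`, `IP'` over `ℝ⁴`) are diffeomorphic —
`nonempty_diffeomorph_of_isConnectedSum_of_discs_equivalent` (unoriented disc theorem in `M`,
uniqueness of open gluings) fed with `sphereOneProdSphereThree_discs_equivalent` (Kervaire–Milnor
(1963), Lemma 2.1 and the remark that an orientation-reversing automorphism of a summand makes
the orientation convention immaterial; Kosinski (1993), VI (1.1)).
[cite: KervaireMilnorAnnals1963, §2, Lemma 2.1 (p. 505)] [cite: Kosinski1993, Ch. VI §1, Thm (1.1)] -/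
theorem nonempty_diffeomorph_of_isConnectedSum_sphereOneProdSphereThree [ConnectedSpace M]
    (h : IsConnectedSum IP IM ((𝓡 1).prod (𝓡 3)) M
      (Metric.sphere (0 : EuclideanSpace ℝ (Fin 2)) 1 × Metric.sphere (0 : EuclideanSpace ℝ (Fin 4)) 1)
      P)
    (h' : IsConnectedSum IP' IM ((𝓡 1).prod (𝓡 3)) M
      (Metric.sphere (0 : EuclideanSpace ℝ (Fin 2)) 1 × Metric.sphere (0 : EuclideanSpace ℝ (Fin 4)) 1)
      P') :
    Nonempty (P ≃ₘ⟮IP, IP'⟯ P') := by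
  obtain ⟨-, r, -, hr, -⟩ := exists_split_reflection_one_three
  have hE : finrank ℝ (EuclideanSpace ℝ (Fin 4)) ≠ 0 := by simp
  exact nonempty_diffeomorph_of_isConnectedSum_of_discs_equivalent hE r hr
    sphereOneProdSphereThree_discs_equivalent h h'

/-- **`M # (Circle × 𝕊³)` is well defined up to diffeomorphism** (the summand of
`IsCircleProdSum`): for a connected Hausdorff `C^∞` manifold `M` with any real model over `ℝ⁴`,
any two connected sums `P`, `P'` of `M` with `Circle × 𝕊³` (any models `IP`, `IP'` over `ℝ⁴`)
are diffeomorphic, by `nonempty_diffeomorph_of_isConnectedSum_of_discs_equivalent` and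
`circleProdSphereThree_discs_equivalent` (Kervaire–Milnor (1963), Lemma 2.1; Kosinski (1993),
VI (1.1)). [cite: KervaireMilnorAnnals1963, §2, Lemma 2.1 (p. 505)]
[cite: Kosinski1993, Ch. VI §1, Thm (1.1)] -/
theorem nonempty_diffeomorph_of_isConnectedSum_circleProdSphereThree [ConnectedSpace M]
    (h : IsConnectedSum IP IM ((𝓡 1).prod (𝓡 3)) M
      (Circle × Metric.sphere (0 : EuclideanSpace ℝ (Fin 4)) 1) P)
    (h' : IsConnectedSum IP' IM ((𝓡 1).prod (𝓡 3)) M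
      (Circle × Metric.sphere (0 : EuclideanSpace ℝ (Fin 4)) 1) P') :
    Nonempty (P ≃ₘ⟮IP, IP'⟯ P') := by
  obtain ⟨-, r, -, hr, -⟩ := exists_split_reflection_one_three
  have hE : finrank ℝ (EuclideanSpace ℝ (Fin 4)) ≠ 0 := by simp
  exact nonempty_diffeomorph_of_isConnectedSum_of_discs_equivalent hE r hr
    circleProdSphereThree_discs_equivalent h h'

end WellDefined

/-! ### `IsCircleProdSum k` has one diffeomorphism type -/

/-- **Two `4`-manifolds which are `#ᵏ(S¹ × S³)` in the sense of `IsCircleProdSum k` are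
diffeomorphic** (`C^∞` manifolds on `ℝ⁴`, same universe).  Induction on `k`: for `k = 0` both
are diffeomorphic to `S⁴` (`isCircleProdSum_zero_iff`); for `k + 1`, `P` is a connected sum
`M # (Circle × 𝕊³)` and `P'` a connected sum `M' # (Circle × 𝕊³)` of closed connected smooth `M`,
`M'` with `IsCircleProdSum k M`, `IsCircleProdSum k M'`, so `M ≅ M'` by induction; transporting
the first connected sum along this diffeomorphism (`IsConnectedSum.of_diffeomorph_left`,
Kervaire–Milnor §2) makes `P` and `P'` two connected sums of the connected manifold `M'` with
`Circle × 𝕊³`, which are diffeomorphic by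
`nonempty_diffeomorph_of_isConnectedSum_circleProdSphereThree`.  (Kervaire–Milnor (1963),
Lemma 2.1: "The connected sum operation is well defined, associative, and commutative up to
orientation preserving diffeomorphism"; no orientations are needed here since `S¹ × S³` is
amphichiral; this is what makes "`X ≅ #ᵏ(S¹ × S³)`" in Meier–Schirmer–Zupan's Thm. 1.2 a
statement about one diffeomorphism type.) [cite: KervaireMilnorAnnals1963, §2, Lemma 2.1 (p. 505)]
[cite: MeierSchirmerZupan2016, Thm. 1.2] -/
theorem IsCircleProdSum.nonempty_diffeomorph :
    ∀ (k : ℕ) (P : Type u) [TopologicalSpace P] [ChartedSpace (EuclideanSpace ℝ (Fin 4)) P]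
      [IsManifold (𝓡 4) ∞ P]
      (P' : Type u) [TopologicalSpace P'] [ChartedSpace (EuclideanSpace ℝ (Fin 4)) P']
      [IsManifold (𝓡 4) ∞ P'],
      IsCircleProdSum k P → IsCircleProdSum k P' → Nonempty (P ≃ₘ⟮𝓡 4, 𝓡 4⟯ P') := by
  intro k
  induction k with
  | zero =>
    intro P _ _ _ P' _ _ _ h h'
    obtain ⟨e⟩ := isCircleProdSum_zero_iff.mp h
    obtain ⟨e'⟩ := isCircleProdSum_zero_iff.mp h'
    exact ⟨e.trans e'.symm⟩
  | succ k ih =>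
    intro P _ _ _ P' _ _ _ h h'
    obtain ⟨M, _, _, _, _, _, _, _, hM, hsum⟩ := isCircleProdSum_succ_iff.mp h
    obtain ⟨M', _, _, _, _, _, _, _, hM', hsum'⟩ := isCircleProdSum_succ_iff.mp h'
    obtain ⟨φ⟩ := ih M M' hM hM'
    exact nonempty_diffeomorph_of_isConnectedSum_circleProdSphereThree (hsum.of_diffeomorph_left φ)
      hsum'

/-- **Two manifolds which are `#ᵏ(S¹ × S³)` are diffeomorphic, across universes**: shrink both
to a common universe (`IsCircleProdSum.shrink_iff`, `ManifoldShrink.diffeomorph`) and apply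
`IsCircleProdSum.nonempty_diffeomorph`. [cite: KervaireMilnorAnnals1963, §2, Lemma 2.1 (p. 505)] -/
theorem IsCircleProdSum.nonempty_diffeomorph_univ {k : ℕ} {P : Type u} [TopologicalSpace P]
    [T2Space P] [SecondCountableTopology P] [ChartedSpace (EuclideanSpace ℝ (Fin 4)) P]
    [IsManifold (𝓡 4) ∞ P] {P' : Type v} [TopologicalSpace P'] [T2Space P']
    [SecondCountableTopology P'] [ChartedSpace (EuclideanSpace ℝ (Fin 4)) P']
    [IsManifold (𝓡 4) ∞ P'] (h : IsCircleProdSum k P) (h' : IsCircleProdSum k P') :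
    Nonempty (P ≃ₘ⟮𝓡 4, 𝓡 4⟯ P') := by
  haveI : Small.{0} P := small_of_secondCountableTopology P
  haveI : Small.{0} P' := small_of_secondCountableTopology P'
  let ψ : Shrink.{0} P ≃ₘ⟮𝓡 4, 𝓡 4⟯ P := ManifoldShrink.diffeomorph (𝓡 4) P ∞
  let ψ' : Shrink.{0} P' ≃ₘ⟮𝓡 4, 𝓡 4⟯ P' := ManifoldShrink.diffeomorph (𝓡 4) P' ∞
  obtain ⟨e⟩ := IsCircleProdSum.nonempty_diffeomorph k (Shrink.{0} P) (Shrink.{0} P')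
    (IsCircleProdSum.shrink_iff.mpr h) (IsCircleProdSum.shrink_iff.mpr h')
  exact ⟨ψ.symm.trans (e.trans ψ')⟩

/-- **`IsCircleProdSum k` is a diffeomorphism class**: if `IsCircleProdSum k P` then, for a
`C^∞` manifold `P'` (same universe), `IsCircleProdSum k P'` iff `P' ≅ P`
(`IsCircleProdSum.of_diffeomorph` one way, `IsCircleProdSum.nonempty_diffeomorph` the other). So
"`X` is diffeomorphic to `#ᵏ(S¹ × S³)`" in the printed sense (diffeomorphic to one, equivalently
any, connected sum of `k` copies) and `IsCircleProdSum k X` agree.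
[cite: KervaireMilnorAnnals1963, §2, Lemma 2.1 (p. 505)] [cite: MeierSchirmerZupan2016, Thm. 1.2] -/
theorem IsCircleProdSum.iff_nonempty_diffeomorph {k : ℕ} {P : Type u} [TopologicalSpace P]
    [ChartedSpace (EuclideanSpace ℝ (Fin 4)) P] [IsManifold (𝓡 4) ∞ P] (h : IsCircleProdSum k P)
    {P' : Type u} [TopologicalSpace P'] [ChartedSpace (EuclideanSpace ℝ (Fin 4)) P']
    [IsManifold (𝓡 4) ∞ P'] :
    IsCircleProdSum k P' ↔ Nonempty (P' ≃ₘ⟮𝓡 4, 𝓡 4⟯ P) :=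
  ⟨fun h' => IsCircleProdSum.nonempty_diffeomorph k P' P h' h, fun ⟨e⟩ => h.of_diffeomorph e.symm⟩

/-! ### The unit `S⁴` and the first summand -/

section Unit

variable {m : ℕ} {P : Type u} [TopologicalSpace P] [T2Space P]
  [ChartedSpace (EuclideanSpace ℝ (Fin 4)) P] [IsManifold (𝓡 4) ∞ P]
  {X : Type v} [TopologicalSpace X] [ChartedSpace (EuclideanSpace ℝ (Fin 4)) X]
  [IsManifold (𝓡 4) ∞ X]

/-- **`P # S⁴` has as many `S¹ × S³` summands as `P`**: if `IsCircleProdSum m P` and `X` is a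
connected sum of `P` with the round `𝕊⁴` (along arbitrary discs), then `IsCircleProdSum m X` —
`X ≅ P` by "`Sⁿ` serves as identity element" (Kervaire–Milnor 1963, Lemma 2.1; the tree's proved
`nonempty_diffeomorph_of_isConnectedSum_sphere'`, Palais' disc theorem in `S⁴`), and the class is
invariant under diffeomorphism (`IsCircleProdSum.of_diffeomorph_univ`).
[cite: KervaireMilnor1963, §2, Lemma 2.1 ("Sⁿ serves as identity element")] -/
theorem IsCircleProdSum.of_isConnectedSum_sphere_right (hP : IsCircleProdSum m P)
    (h : IsConnectedSum (𝓡 4) (𝓡 4) (𝓡 4) P (Metric.sphere (0 : EuclideanSpace ℝ (Fin 5)) 1) X) :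
    IsCircleProdSum m X := by
  obtain ⟨e⟩ := nonempty_diffeomorph_of_isConnectedSum_sphere' h
  exact hP.of_diffeomorph_univ e.symm

/-- **`P # Q` with `Q ≅ S⁴` has as many `S¹ × S³` summands as `P`** (`IsCircleProdSum 0 Q` says
`Q ≅ 𝕊⁴`): transport the second summand to `𝕊⁴` (`IsConnectedSum.of_diffeomorph_right`) and use
`IsCircleProdSum.of_isConnectedSum_sphere_right`.  This is the `#⁰(S¹ × S³) = S⁴` bookkeeping of
Meier–Schirmer–Zupan's induction (a genus-one summand trisecting `S⁴` does not change the
diffeomorphism type). [cite: KervaireMilnor1963, §2, Lemma 2.1 ("Sⁿ serves as identity element")]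
[cite: MeierZupan2017, §1 ("#^0(S¹ × S³) = S⁴")] -/
theorem IsCircleProdSum.of_isConnectedSum_zero_right {Q : Type*} [TopologicalSpace Q] [T2Space Q]
    [ChartedSpace (EuclideanSpace ℝ (Fin 4)) Q] [IsManifold (𝓡 4) ∞ Q] (hP : IsCircleProdSum m P)
    (hQ : IsCircleProdSum 0 Q) (h : IsConnectedSum (𝓡 4) (𝓡 4) (𝓡 4) P Q X) :
    IsCircleProdSum m X := by
  obtain ⟨e⟩ := isCircleProdSum_zero_iff.mp hQ
  exact hP.of_isConnectedSum_sphere_right (h.of_diffeomorph_right e)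

/-- **`Q # P` with `Q ≅ S⁴` has as many `S¹ × S³` summands as `P`** (the symmetric form of
`IsCircleProdSum.of_isConnectedSum_zero_right`, by the commutativity `isConnectedSum_comm`).
[cite: KervaireMilnor1963, §2, Lemma 2.1 ("Sⁿ serves as identity element")] -/
theorem IsCircleProdSum.of_isConnectedSum_zero_left {Q : Type*} [TopologicalSpace Q] [T2Space Q]
    [ChartedSpace (EuclideanSpace ℝ (Fin 4)) Q] [IsManifold (𝓡 4) ∞ Q] (hQ : IsCircleProdSum 0 Q)
    (hP : IsCircleProdSum m P) (h : IsConnectedSum (𝓡 4) (𝓡 4) (𝓡 4) Q P X) :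
    IsCircleProdSum m X :=
  hP.of_isConnectedSum_zero_right hQ h.symm

end Unit

section Succ

variable {n : ℕ} {M X : Type u} [TopologicalSpace M] [T2Space M] [SecondCountableTopology M]
  [ChartedSpace (EuclideanSpace ℝ (Fin 4)) M] [IsManifold (𝓡 4) ∞ M] [CompactSpace M]
  [ConnectedSpace M] [TopologicalSpace X] [ChartedSpace (EuclideanSpace ℝ (Fin 4)) X]
  [IsManifold (𝓡 4) ∞ X]
  {EN HN : Type*} [NormedAddCommGroup EN] [NormedSpace ℝ EN] [FiniteDimensional ℝ EN]
  [TopologicalSpace HN] {IN : ModelWithCorners ℝ EN HN} [IN.Boundaryless]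
  {N : Type*} [TopologicalSpace N] [T2Space N] [ChartedSpace HN N] [IsManifold IN ∞ N]

/-- **Splitting off a summand diffeomorphic to `S¹ × S³`**: if `X` is a connected sum `M # N` of a
closed connected smooth `M` with `IsCircleProdSum n M` and of a `4`-manifold `N` (any boundaryless
real model of dimension `4`) diffeomorphic to `Circle × 𝕊³`, then `IsCircleProdSum (n + 1) X`:
transport the summand `N` to `Circle × 𝕊³` across models
(`IsConnectedSum.of_diffeomorph_right_of_boundaryless`, Kervaire–Milnor §2 "well defined") and
apply the constructor `IsCircleProdSum.succ`. [cite: KervaireMilnor1963, §2] -/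
theorem IsCircleProdSum.succ_of_diffeomorph (hM : IsCircleProdSum n M)
    (h : IsConnectedSum (𝓡 4) (𝓡 4) IN M N X) (hEN : finrank ℝ EN = 4)
    (ψ : N ≃ₘ⟮IN, (𝓡 1).prod (𝓡 3)⟯ (Circle × Metric.sphere (0 : EuclideanSpace ℝ (Fin 4)) 1)) :
    IsCircleProdSum (n + 1) X := by
  have L : EN ≃L[ℝ] (EuclideanSpace ℝ (Fin 1) × EuclideanSpace ℝ (Fin 3)) :=
    ContinuousLinearEquiv.ofFinrankEq (by rw [hEN]; simp)
  have LP : EN ≃L[ℝ] EuclideanSpace ℝ (Fin 4) :=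
    ContinuousLinearEquiv.ofFinrankEq (by rw [hEN]; simp)
  exact .succ hM (h.of_diffeomorph_right_of_boundaryless ψ (by rw [hEN]; simp) L LP)

end Succ

/-- **Splitting off a summand on `ℝ⁴` diffeomorphic to `S¹ × S³`** (the case of
`IsCircleProdSum.succ_of_diffeomorph` for a summand charted on `ℝ⁴`, e.g. a closed `4`-manifold
recognised as `S¹ × S³` by a handle argument). [cite: KervaireMilnor1963, §2] -/
theorem IsCircleProdSum.succ_of_diffeomorph_euclidean {n : ℕ} {M X : Type u} [TopologicalSpace M]
    [T2Space M] [SecondCountableTopology M] [ChartedSpace (EuclideanSpace ℝ (Fin 4)) M]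
    [IsManifold (𝓡 4) ∞ M] [CompactSpace M] [ConnectedSpace M] [TopologicalSpace X]
    [ChartedSpace (EuclideanSpace ℝ (Fin 4)) X] [IsManifold (𝓡 4) ∞ X]
    {N : Type*} [TopologicalSpace N] [T2Space N] [ChartedSpace (EuclideanSpace ℝ (Fin 4)) N]
    [IsManifold (𝓡 4) ∞ N] (hM : IsCircleProdSum n M)
    (h : IsConnectedSum (𝓡 4) (𝓡 4) (𝓡 4) M N X)
    (ψ : N ≃ₘ⟮𝓡 4, (𝓡 1).prod (𝓡 3)⟯ (Circle × Metric.sphere (0 : EuclideanSpace ℝ (Fin 4)) 1)) :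
    IsCircleProdSum (n + 1) X :=
  hM.succ_of_diffeomorph h (by simp) ψ

/-- **A manifold diffeomorphic to `S¹ × S³` is `#¹(S¹ × S³)`** (any universe; cross-model
diffeomorphism onto Mathlib's `Circle × 𝕊³`): for the copy `R` of `Circle × 𝕊³` charted on `ℝ⁴`
(`exists_rechart_circle_prod_sphereThree`), `R` is a connected sum `R # S⁴`
(`isConnectedSum_sphere_self_holds`, Kervaire–Milnor's identity element), i.e. `S⁴ # R` with
`R ≅ Circle × 𝕊³`, so `IsCircleProdSum 1 R` (`IsCircleProdSum.succ_of_diffeomorph_euclidean` over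
`IsCircleProdSum.sphere_self`); then transport along `R ≅ Circle × 𝕊³ ≅ X`
(`IsCircleProdSum.of_diffeomorph_univ`). [cite: KervaireMilnor1963, §2, Lemma 2.1]
[cite: MeierZupan2017, §1 ("#^0(S¹ × S³) = S⁴")] -/
theorem IsCircleProdSum.one_of_diffeomorph {X : Type u} [TopologicalSpace X]
    [ChartedSpace (EuclideanSpace ℝ (Fin 4)) X] [IsManifold (𝓡 4) ∞ X]
    (ψ : X ≃ₘ⟮𝓡 4, (𝓡 1).prod (𝓡 3)⟯ (Circle × Metric.sphere (0 : EuclideanSpace ℝ (Fin 4)) 1)) :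
    IsCircleProdSum 1 X := by
  obtain ⟨R, _, _, _, _, _, ⟨Φ⟩⟩ := exists_rechart_circle_prod_sphereThree
  haveI : Nonempty R :=
    ⟨Φ.symm ((1 : Circle), ⟨EuclideanSpace.single 0 1, by simp⟩)⟩
  haveI : ConnectedSpace (Metric.sphere (0 : EuclideanSpace ℝ (Fin 5)) 1) := by
    refine isConnected_iff_connectedSpace.mp (isConnected_sphere ?_ 0 zero_le_one)
    rw [← Module.finrank_eq_rank, finrank_euclideanSpace_fin]
    norm_num
  -- `R = S⁴ # R`, hence `IsCircleProdSum 1 R`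
  have hR : IsConnectedSum (𝓡 4) (𝓡 4) (𝓡 4) (Metric.sphere (0 : EuclideanSpace ℝ (Fin 5)) 1) R R :=
    (isConnectedSum_sphere_self_holds (n := 4) R).symm
  have h1 : IsCircleProdSum 1 R := IsCircleProdSum.sphere_self.succ_of_diffeomorph_euclidean hR Φ
  exact h1.of_diffeomorph_univ (Φ.trans ψ.symm)

end Literature.Topology.FourManifolds

end
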